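import Summits.BirchSwinnertonDyer.Rank1Residual.X2.SplitCellCClassIntPNewNotGV
import Summits.BirchSwinnertonDyer.Rank1Residual.X2.ManinEtaleSwitch
import Summits.BirchSwinnertonDyer.Rank1Residual.X2.TwistParityStability
import Summits.BirchSwinnertonDyer.Rank1Residual.X2.RouteGSplitDisplay80934e1Local
import Summits.BirchSwinnertonDyer.Rank1Residual.Partition.GreenbergVatsalIsogenyClassPeriod
import Literature.NumberTheory.EllipticCurves.IsogenyFormulaCertKronecker
import Literature.NumberTheory.EllipticCurves.IsogenyFormulaDegree
import Literature.NumberTheory.EllipticCurves.IsogenyConductorProofs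
import Literature.NumberTheory.EllipticCurves.MazurTorsionGaloisStructureProofs
import HarnessLib

/-!
# Row B11 ∩ SPLIT — the ÉTALE-SWITCH PILOT at the class `155a` (`p = 5`), part 1 (LOCAL DATA IN THE
# KERNEL): the two equations, the certified `5`-isogeny and its degree, the étale direction, the
# reduction types, the Galois side from the rational `5`-torsion point, the local datum at the étale end (cell `bsd-eis`, seat `bsd-eis-cgshw` g9; route `EisensteinPrimes`, crux 4 `BSDpOnCellC` =
# stmt-BirchSwinnertonDyer-19034, line b1 skeleton v7, stub `stub_ctlOrSwitch`; RULINGS L14 (c) / L15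
# AMENDMENT «the per-pair switch pilot (C) may proceed with the DD15 fact as a binder»)

HONEST FRAMING (cell `bsd-eis`, run/shared/lean/pub/bsd-eis/): ONE isogeny certificate (data, checked by
`decide +kernel`) + theorems; nothing booked; X2 stays CONSTRUCTION-SHAPED; no label or count moves;
`BSD` is not proved for any curve unconditionally — the display is CONDITIONAL on the named facts below.

THE CLASS. `W₀ = 155a1 = [0, −1, 1, 10, 6]` (`N = 5·31`, `Δ = −5⁵·31`, `E(ℚ)_tors = ℤ/5` generated by
`P = (0, 2)`, `r_an = 1` — an X2c pair at the SPLIT prime `5`, cgshw MEMO-11 window row `155a1@5`: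
the optimal curve has `W₀(ℚ_5)[5] ≠ 0`) and its étale `5`-quotient `W₁ = W₀/⟨P⟩ = [0, −1, 1, −840,
−9114]` (`Δ = −5·31⁵`, torsion-free, split at `5`, `v_5(Δ_min) = 1` so `W₁(ℚ_5)[5] = 0`; kit j253709).

IN THE KERNEL (§1–§4): both equations elliptic and globally minimal; SPLIT multiplicative at `5` (node
quadratic has a root mod `5`); the rational map `(x, y) ↦ (U/h², (S y + T)/h³)` with
`h = x² − 5x`, `U = x⁵ − 10x⁴ + 195x³ − 300x² + 250x + 625`, … IS an isogeny `φ : W₀ → W₁` (tree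
`IsogenyCert`, Silverman III.4.8) of degree `5` (`degree_toIsogeny`, coprimality certified mod `10007`);
`v_5(j(W₀)) = −5 = 5·v_5(j(W₁))` (the kernel `⟨P⟩` is the ÉTALE line — DD15 Thm. A.1, here also Thm.
8.2: `ker φ ⊂ E(ℚ)`); `5 • P = 0` by two chord–tangent steps (`2P = (5, −13)`, `3P = (5, 12) = −2P`), so
`W₀[5]` is reducible and `¬ GVPar W₀ 5` (a rational `5`-torsion point at a multiplicative prime:
`X2.not_gvPar_of_nsmul_eq_zero_of_mult`), both transported to `W₁` along `φ`; `5 ∤ v_5(Δ_min W₁) = 1`.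

THE DISPLAY (part 2, `X2/RankOneSplitSwitchDisplay155a.lean`) `bsdp_of_isIsogenous_155a1_at_five`: for every globally minimal `W ∼ W₀`,
`BSD(W, 5)` from — [PUB, registered named facts] the 23 of `stub_publishedFacts` that the split road
uses + cas-split `hCS` (`thm210_thm211_bdpDisplay_pNew`) + the two Tate-uniformisation facts `hT hT'`
+ Ogg–Saito in Galois form `hOS` (conductor is an isogeny invariant) + the DD15/Stevens Manin transport
`hDS` (`X2.dokchitserStevens_maninDatum_of_pIsogeny`, cited fact, cell referee W-g16-2); [PRE]
`h3 : SplitIMCEqOnTreeInt W₁ 5` = Keller–Yin Thm. 5.1.3 at the ONE curve `W₁`; [per class, instrument]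
`hr : r_an(W₁) = 1` (Cremona allbsd / PARI ellanalyticrank) and `hMan₀ : HasPrimeToManinDatum W₀ 5`
(`155a1` is the `X₀(155)`-optimal curve, Manin constant `1` — Cremona; class-wide this is Mazur's theorem
at the optimal curve, `X2.exists_isIsogenous_hasPrimeToManinDatum`). ROAD: the ψ-even split pointwise
theorem at `W₁` (`bsdp_of_cellCSplitNotGV_of_manin_of_pNewValue_of_imcInt_of_ctl`: value half FROM
PRINT, partner in the closed sub-cell X2a, CTL-split the THEOREM `splitControlOnTree_of_cellC_of_noPadicPTorsion`
since `W₁(ℚ_5)[5] = 0`, Manin datum transported along `φ` by `hasPrimeToManinDatum_of_pIsogeny`), then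
Cassels. NO c1s, NO c2s, NO crux 3, NO CTL input — the switch disjunct of `stub_ctlOrSwitch` EXHIBITED.
What this is NOT: not a booking of `(155a, 5)`; `N = 155 < 5000` (a pilot of the mechanism, not judge
note (b)'s instance); Keller–Yin's IMC stays PRE.

References: [DokchitserDokchitser2015LocalInvariants] Prop. 4.10, Thm. 8.2, Thm. A.1; [Stevens1989] (2.2);
[Castella2018Exceptional] Thms. 2.10–2.11; [KellerYin2024] Thm. 5.1.3 (PRE); [SilvermanAEC2009] III.2.3,
III.4.8, III.4.10, VII.5.1; [SilvermanATAEC1994] IV.10–11, V.5.3–5.4; [Mazur1978] Cor. 4.1; Cremona ecdata 155a.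
-/

set_option autoImplicit false

noncomputable section

open scoped Classical MatrixGroups ModularForm

open Polynomial CongruenceSubgroup WeierstrassCurve NumberField IsDedekindDomain Field
  Literature.NumberTheory.EllipticCurves Literature.NumberTheory.EllipticCurves.PolyCert
  Literature.NumberTheory.EllipticCurves.GreenbergSelmer
  Literature.NumberTheory.EllipticCurves.ModularForms Literature.NumberTheory.QuadraticFields
  Literature.NumberTheory.EllipticCurves.Rank1Residual
  Literature.NumberTheory.EllipticCurves.Rank1Residual.Typed
  Literature.NumberTheory.EllipticCurves.KrizLi2019
  Literature.NumberTheory.EllipticCurves.GreenbergVatsal2000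
  Literature.NumberTheory.EllipticCurves.Wuthrich2014
  Literature.NumberTheory.EllipticCurves.SteinWuthrich2013
  Literature.NumberTheory.EllipticCurves.Castella2018
  Literature.NumberTheory.EllipticCurves.Castella2018Exceptional
  Literature.NumberTheory.GaloisRepresentations Literature.NumberTheory.GaloisCohomology
  Literature.NumberTheory.Automorphic
  Summit.BirchSwinnertonDyer.BirchSwinnertonDyer.Rank1Residual.IntModel
  Summit.BirchSwinnertonDyer.BirchSwinnertonDyer.Rank1Residual.X11RankOne
  Summit.BirchSwinnertonDyer.Rank1Residual.X11b.AcSelmer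
  Summit.BirchSwinnertonDyer.Rank1Residual.X11b.Halves
  Summit.BirchSwinnertonDyer.Rank1Residual.X11b
  Summit.BirchSwinnertonDyer.Rank1Residual

namespace Summit.BirchSwinnertonDyer.Rank1Residual.X2.RankOneSplitSwitchDisplay155a

/-! ## §1 The two equations: elliptic, globally minimal, SPLIT multiplicative at `5` -/

/-- `155a1 = [0, −1, 1, 10, 6]` is elliptic (`Δ = −96875 ≠ 0`). [folklore] -/
theorem isElliptic_W₀ : (⟨0, -1, 1, 10, 6⟩ : WeierstrassCurve ℚ).IsElliptic :=
  isElliptic_of_discOf_ne_zero 0 (-1) 1 10 6 (by decide +kernel)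

/-- `W₁ = [0, −1, 1, −840, −9114]` is elliptic (`Δ = −143145755 ≠ 0`). [folklore] -/
theorem isElliptic_W₁ : (⟨0, -1, 1, -840, -9114⟩ : WeierstrassCurve ℚ).IsElliptic :=
  isElliptic_of_discOf_ne_zero 0 (-1) 1 (-840) (-9114) (by decide +kernel)

set_option maxRecDepth 100000 in
/-- `155a1` is globally minimal (bounded Kraus–Silverman criterion, `decide`).
[cite: SilvermanAEC2009, VII.1 Remark 1.1] -/
theorem isGloballyMinimal_W₀ : (⟨0, -1, 1, 10, 6⟩ : WeierstrassCurve ℚ).IsGloballyMinimal :=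
  isGloballyMinimal_of_krausCriterion_bounded 0 (-1) 1 10 6
    (by decide +kernel) (by decide +kernel) (by decide +kernel)

set_option maxRecDepth 100000 in
/-- `W₁` is globally minimal (bounded Kraus–Silverman criterion, `decide`).
[cite: SilvermanAEC2009, VII.1 Remark 1.1] -/
theorem isGloballyMinimal_W₁ : (⟨0, -1, 1, -840, -9114⟩ : WeierstrassCurve ℚ).IsGloballyMinimal :=
  isGloballyMinimal_of_krausCriterion_bounded 0 (-1) 1 (-840) (-9114)
    (by decide +kernel) (by decide +kernel) (by decide +kernel)

/-- **`155a1` is SPLIT multiplicative at `5`** (`5 ∣ Δ`, `5 ∤ c₄`; the node-tangent quadratic has a root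
mod `5`). [cite: SilvermanAEC2009, VII.5 Prop. 5.1(b)] -/
theorem split_W₀ : (⟨0, -1, 1, 10, 6⟩ : WeierstrassCurve ℚ).HasMultiplicativeReductionAtPrime 5 ∧
    (⟨0, -1, 1, 10, 6⟩ : WeierstrassCurve ℚ).HasSplitMultiplicativeReductionAtPrime 5 := by
  haveI := isElliptic_W₀
  haveI := isGloballyMinimal_W₀
  have hI := integralModelInt_eq_of_map_eq (W := (⟨0, -1, 1, 10, 6⟩ : WeierstrassCurve ℚ)) _
    (map_mk_int 0 (-1) 1 10 6)
  exact ⟨hasMultiplicativeReductionAtPrime_of_intModel hI 5 (by rw [intCurve_Δ]; decide +kernel)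
      (by rw [intCurve_c₄]; decide +kernel),
    hasSplitMultiplicativeReductionAtPrime_of_intModel_of_root hI 5 (by rw [intCurve_Δ]; decide +kernel)
      (by rw [intCurve_c₄]; decide +kernel) (by
        simp only [WeierstrassCurve.c₄, WeierstrassCurve.b₂, WeierstrassCurve.b₄, WeierstrassCurve.b₆]
        push_cast; decide)⟩

/-- **`W₁` is SPLIT multiplicative at `5`** (`5 ∣ Δ`, `5 ∤ c₄`; the node-tangent quadratic has a root
mod `5`). [cite: SilvermanAEC2009, VII.5 Prop. 5.1(b)] -/
theorem split_W₁ : (⟨0, -1, 1, -840, -9114⟩ : WeierstrassCurve ℚ).HasMultiplicativeReductionAtPrime 5 ∧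
    (⟨0, -1, 1, -840, -9114⟩ : WeierstrassCurve ℚ).HasSplitMultiplicativeReductionAtPrime 5 := by
  haveI := isElliptic_W₁
  haveI := isGloballyMinimal_W₁
  have hI := integralModelInt_eq_of_map_eq (W := (⟨0, -1, 1, -840, -9114⟩ : WeierstrassCurve ℚ)) _
    (map_mk_int 0 (-1) 1 (-840) (-9114))
  exact ⟨hasMultiplicativeReductionAtPrime_of_intModel hI 5 (by rw [intCurve_Δ]; decide +kernel)
      (by rw [intCurve_c₄]; decide +kernel),
    hasSplitMultiplicativeReductionAtPrime_of_intModel_of_root hI 5 (by rw [intCurve_Δ]; decide +kernel)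
      (by rw [intCurve_c₄]; decide +kernel) (by
        simp only [WeierstrassCurve.c₄, WeierstrassCurve.b₂, WeierstrassCurve.b₄, WeierstrassCurve.b₆]
        push_cast; decide)⟩

/-- **The local datum at the étale end: `v_5(Δ_min(W₁)) = 1`, so `5 ∤ v_5(Δ_min(W₁))`** (hence
`W₁(ℚ_5)[5] = 0` by `X11b.LocalTorsion.localTorsion_eq_zero_of_mult`). [cite: SilvermanAEC2009, Thm VII.6.1] -/
theorem not_dvd_val_minimalDiscriminant_W₁ [(⟨0, -1, 1, -840, -9114⟩ : WeierstrassCurve ℚ).IsGloballyMinimal] :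
    ¬ 5 ∣ padicValInt 5 (⟨0, -1, 1, -840, -9114⟩ : WeierstrassCurve ℚ).minimalDiscriminantInt := by
  have hI := integralModelInt_eq_of_map_eq (W := (⟨0, -1, 1, -840, -9114⟩ : WeierstrassCurve ℚ)) _
    (map_mk_int 0 (-1) 1 (-840) (-9114))
  haveI : Fact (Nat.Prime 5) := ⟨by norm_num⟩
  rw [minimalDiscriminantInt_eq hI, padicValInt_eq_of_dvd_of_not_dvd 5 (e := 1)
    (by rw [intCurve_Δ]; decide +kernel) (by rw [intCurve_Δ]; decide +kernel)]
  decide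

/-- **The étale direction: `v_5(j(W₀)) = −5 = 5 · v_5(j(W₁))`** (`j = c₄³/Δ`; `5 ∤ c₄` on both sides,
`5⁵ ∥ Δ(W₀)`, `5 ∥ Δ(W₁)`) — the hypothesis of DD15 Prop. 4.10 / Thm. A.1 singling out the NON-`μ`
kernel. [cite: DokchitserDokchitser2015LocalInvariants, Prop. 4.10 and Thm. A.1] [cite: SilvermanAEC2009, III.1] -/
theorem padicValRat_j_W₀_W₁ [(⟨0, -1, 1, 10, 6⟩ : WeierstrassCurve ℚ).IsElliptic]
    [(⟨0, -1, 1, 10, 6⟩ : WeierstrassCurve ℚ).IsGloballyMinimal]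
    [(⟨0, -1, 1, -840, -9114⟩ : WeierstrassCurve ℚ).IsElliptic]
    [(⟨0, -1, 1, -840, -9114⟩ : WeierstrassCurve ℚ).IsGloballyMinimal] :
    padicValRat 5 (⟨0, -1, 1, 10, 6⟩ : WeierstrassCurve ℚ).j =
      (5 : ℕ) * padicValRat 5 (⟨0, -1, 1, -840, -9114⟩ : WeierstrassCurve ℚ).j := by
  haveI : Fact (Nat.Prime 5) := ⟨by norm_num⟩
  have hI₀ := integralModelInt_eq_of_map_eq (W := (⟨0, -1, 1, 10, 6⟩ : WeierstrassCurve ℚ)) _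
    (map_mk_int 0 (-1) 1 10 6)
  have hI₁ := integralModelInt_eq_of_map_eq (W := (⟨0, -1, 1, -840, -9114⟩ : WeierstrassCurve ℚ)) _
    (map_mk_int 0 (-1) 1 (-840) (-9114))
  -- `j = c₄³/Δ` read on the integer models, valuations by `p^e ∥ ·`
  have key : ∀ {W : WeierstrassCurve ℚ} [W.IsElliptic] [W.IsGloballyMinimal] {E₀ : WeierstrassCurve ℤ}
      (_ : integralModelInt W = E₀) (a b : ℕ), (5 : ℤ) ^ a ∣ E₀.c₄ → ¬ (5 : ℤ) ^ (a + 1) ∣ E₀.c₄ →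
      (5 : ℤ) ^ b ∣ E₀.Δ → ¬ (5 : ℤ) ^ (b + 1) ∣ E₀.Δ → padicValRat 5 W.j = 3 * a - b := by
    intro W _ _ E₀ hI a b hca hca' hΔb hΔb'
    have hΔ0 : E₀.Δ ≠ 0 := fun h => hΔb' (h ▸ dvd_zero _)
    have hc0 : E₀.c₄ ≠ 0 := fun h => hca' (h ▸ dvd_zero _)
    have hΔ0' : ((E₀.Δ : ℤ) : ℚ) ≠ 0 := by exact_mod_cast hΔ0
    have hc0' : ((E₀.c₄ : ℤ) : ℚ) ≠ 0 := by exact_mod_cast hc0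
    have hj : W.j = ((E₀.c₄ : ℤ) : ℚ) ^ 3 / ((E₀.Δ : ℤ) : ℚ) := by
      rw [WeierstrassCurve.j, Units.val_inv_eq_inv_val, coe_Δ', Δ_eq_cast hI, c₄_eq_cast hI, div_eq_inv_mul]
    rw [hj, padicValRat.div (pow_ne_zero 3 hc0') hΔ0', padicValRat.pow ((E₀.c₄ : ℤ) : ℚ), padicValRat.of_int,
      padicValRat.of_int, padicValInt_eq_of_dvd_of_not_dvd 5 hca hca',
      padicValInt_eq_of_dvd_of_not_dvd 5 hΔb hΔb']
    push_cast
    ring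
  rw [key hI₀ 0 5 (by rw [intCurve_c₄]; decide +kernel) (by rw [intCurve_c₄]; decide +kernel)
      (by rw [intCurve_Δ]; decide +kernel) (by rw [intCurve_Δ]; decide +kernel),
    key hI₁ 0 1 (by rw [intCurve_c₄]; decide +kernel) (by rw [intCurve_c₄]; decide +kernel)
      (by rw [intCurve_Δ]; decide +kernel) (by rw [intCurve_Δ]; decide +kernel)]
  norm_num

/-! ## §2 The `5`-isogeny `φ : W₀ → W₁` by certificate, and its degree -/

/-- The standard-form certificate of the `5`-isogeny `155a1 → W₁` with kernel polynomial
`h = x² − 5x` (the rational `5`-torsion abscissae `0, 5`): `(x, y) ↦ (U/h², (S y + T)/h³)`; kit j253709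
(PARI `ellisogeny`, change of variables `[1,0,0,0]` onto the minimal model). [cite: SilvermanAEC2009, Thm. III.4.8 and Remark III.4.13.3] -/
def cert155a : IsogenyCert where
  a₁ := 0
  a₂ := -1
  a₃ := 1
  a₄ := 10
  a₆ := 6
  a₁' := 0
  a₂' := -1
  a₃' := 1
  a₄' := -840
  a₆' := -9114
  U := [625, 250, -300, 195, -10, 1]
  h := [0, -5, 1]
  S := [6250, -1250, -750, -375, -95, -15, 1]
  T := [3125, -625, -375, -125, -85]

/-- Bézout certificate modulo `10007` for the coprimality of `U` and `h` of `cert155a`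
(`a Ū + b h̄ = 1 + 10007 q`); kit j253709. [folklore] -/
def cert155aCop : CoprimeCert where
  ℓ := 10007
  a := [5716, 3866]
  b := [8518, 4150, 1801, 3607, 6141]
  q := [357, 8898, 9790, 5662, 9391, 10001, 1]

/-- The certificate checks (fast check at `2³⁶`). [folklore] -/
theorem checkFast_cert155a : cert155a.checkFast 36 = true := by
  decide +kernel

/-- The coprimality certificate checks (at `2³³`). [folklore] -/
theorem checkCoprime_cert155a : cert155a.checkCoprime cert155aCop 33 = true := by
  decide +kernel

/-- **The `5`-isogeny `φ : 155a1 → W₁` as an `Isogeny`** (the tree's `IsogenyFormula.toIsogeny`,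
Silverman *AEC* III.4.8, from the checked certificate). [cite: SilvermanAEC2009, Thm. III.4.8] -/
def isogeny155a [(⟨0, -1, 1, 10, 6⟩ : WeierstrassCurve ℚ).IsElliptic]
    [(⟨0, -1, 1, -840, -9114⟩ : WeierstrassCurve ℚ).IsElliptic] :
    Isogeny (⟨0, -1, 1, 10, 6⟩ : WeierstrassCurve ℚ) (⟨0, -1, 1, -840, -9114⟩ : WeierstrassCurve ℚ) :=
  (cert155a.toFormula (IsogenyCert.check_of_checkFast checkFast_cert155a)
    (⟨0, -1, 1, 10, 6⟩ : WeierstrassCurve ℚ) (⟨0, -1, 1, -840, -9114⟩ : WeierstrassCurve ℚ) rfl rfl).toIsogeny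

/-- **`deg φ = 5`**: `#ker = deg U = |U| − 1 = 5` (`IsogenyFormula.degree_toIsogeny`, *AEC*
III.4.10(a),(c); `U`, `h` coprime by the certificate mod `10007`). [cite: SilvermanAEC2009, Thm. III.4.10(a),(c)] -/
theorem degree_isogeny155a [(⟨0, -1, 1, 10, 6⟩ : WeierstrassCurve ℚ).IsElliptic]
    [(⟨0, -1, 1, -840, -9114⟩ : WeierstrassCurve ℚ).IsElliptic] : isogeny155a.degree = 5 := by
  set φ := cert155a.toFormula (IsogenyCert.check_of_checkFast checkFast_cert155a)
    (⟨0, -1, 1, 10, 6⟩ : WeierstrassCurve ℚ) (⟨0, -1, 1, -840, -9114⟩ : WeierstrassCurve ℚ) rfl rfl with hφ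
  have hcop : IsCoprime (φ.U.map (algebraMap ℚ (AlgebraicClosure ℚ)))
      (φ.h.map (algebraMap ℚ (AlgebraicClosure ℚ))) := by
    change IsCoprime ((ofList cert155a.U : ℚ[X]).map (algebraMap ℚ (AlgebraicClosure ℚ)))
      ((ofList cert155a.h : ℚ[X]).map (algebraMap ℚ (AlgebraicClosure ℚ)))
    rw [IsogenyCert.map_ofList, IsogenyCert.map_ofList]
    exact IsogenyCert.isCoprime_of_checkCoprime checkCoprime_cert155a (by show Nat.Prime 10007; norm_num) _
  have hdeg : φ.toIsogeny.degree = cert155a.U.length - 1 := by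
    rw [φ.degree_toIsogeny hcop]
    change (ofList cert155a.U : ℚ[X]).natDegree = cert155a.U.length - 1
    exact IsogenyCert.natDegree_ofList_eq cert155a.U
      (IsogenyCert.checkFast_spec checkFast_cert155a).2.2.2.2.2.1
  exact hdeg

/-! ## §3 The Galois side from the rational `5`-torsion point `P = (0, 2)` -/

/-- `P = (0, 2)` lies on `155a1` (`2² + 2 = 6`). [folklore] -/
theorem nonsingular_P [(⟨0, -1, 1, 10, 6⟩ : WeierstrassCurve ℚ).IsElliptic] :
    (⟨0, -1, 1, 10, 6⟩ : WeierstrassCurve ℚ).toAffine.Nonsingular (0 : ℚ) (2 : ℚ) :=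
  WeierstrassCurve.Affine.equation_iff_nonsingular.mp
    ((WeierstrassCurve.Affine.equation_iff _ _).mpr (by norm_num))

/-- `Q = (5, −13)` lies on `155a1` (`169 − 13 = 125 − 25 + 50 + 6`). [folklore] -/
theorem nonsingular_Q [(⟨0, -1, 1, 10, 6⟩ : WeierstrassCurve ℚ).IsElliptic] :
    (⟨0, -1, 1, 10, 6⟩ : WeierstrassCurve ℚ).toAffine.Nonsingular (5 : ℚ) (-13 : ℚ) :=
  WeierstrassCurve.Affine.equation_iff_nonsingular.mp
    ((WeierstrassCurve.Affine.equation_iff _ _).mpr (by norm_num))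

/-- **`2P = (5, −13)` for `P = (0, 2) ∈ 155a1(ℚ)`** (tangent slope `2`; Silverman *AEC* III.2.3).
[cite: SilvermanAEC2009, III.2.3 (group law algorithm)] -/
theorem two_P [(⟨0, -1, 1, 10, 6⟩ : WeierstrassCurve ℚ).IsElliptic] :
    (Affine.Point.some (0 : ℚ) (2 : ℚ) nonsingular_P : (⟨0, -1, 1, 10, 6⟩ : WeierstrassCurve ℚ).toAffine.Point) +
        Affine.Point.some (0 : ℚ) (2 : ℚ) nonsingular_P =
      Affine.Point.some (5 : ℚ) (-13 : ℚ) nonsingular_Q := by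
  have hy : (2 : ℚ) ≠ (⟨0, -1, 1, 10, 6⟩ : WeierstrassCurve ℚ).toAffine.negY 0 2 := by
    norm_num [Affine.negY]
  rw [Affine.Point.add_self_of_Y_ne hy]
  have hs : (⟨0, -1, 1, 10, 6⟩ : WeierstrassCurve ℚ).toAffine.slope 0 0 2 2 = 2 := by
    rw [Affine.slope_of_Y_ne rfl hy]; norm_num [Affine.negY]
  simp only [Affine.Point.some.injEq]
  refine ⟨?_, ?_⟩
  · rw [hs]; norm_num [Affine.addX]
  · rw [hs]; norm_num [Affine.addY, Affine.addX, Affine.negAddY, Affine.negY]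

/-- **`2P + P = (5, 12) = −2P`** (chord slope `−3`; Silverman *AEC* III.2.3).
[cite: SilvermanAEC2009, III.2.3 (group law algorithm)] -/
theorem two_P_add_P [(⟨0, -1, 1, 10, 6⟩ : WeierstrassCurve ℚ).IsElliptic] :
    (Affine.Point.some (5 : ℚ) (-13 : ℚ) nonsingular_Q : (⟨0, -1, 1, 10, 6⟩ : WeierstrassCurve ℚ).toAffine.Point) +
        Affine.Point.some (0 : ℚ) (2 : ℚ) nonsingular_P =
      -Affine.Point.some (5 : ℚ) (-13 : ℚ) nonsingular_Q := by
  have hx : (5 : ℚ) ≠ 0 := by norm_num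
  rw [Affine.Point.add_of_X_ne hx, Affine.Point.neg_some]
  have hs : (⟨0, -1, 1, 10, 6⟩ : WeierstrassCurve ℚ).toAffine.slope 5 0 (-13) 2 = -3 := by
    rw [Affine.slope_of_X_ne hx]; norm_num
  simp only [Affine.Point.some.injEq]
  refine ⟨?_, ?_⟩
  · rw [hs]; norm_num [Affine.addX]
  · rw [hs]; norm_num [Affine.addY, Affine.addX, Affine.negAddY, Affine.negY]

/-- **`5 • P = O` for `P = (0, 2) ∈ 155a1(ℚ)`**: `5P = 2P + (2P + P) = 2P + (−2P) = O`.
[cite: SilvermanAEC2009, III.2.3 (group law algorithm)] -/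
theorem five_smul_P [(⟨0, -1, 1, 10, 6⟩ : WeierstrassCurve ℚ).IsElliptic] :
    (5 : ℕ) • (Affine.Point.some (0 : ℚ) (2 : ℚ) nonsingular_P :
      (⟨0, -1, 1, 10, 6⟩ : WeierstrassCurve ℚ).toAffine.Point) = 0 := by
  have h5 : ∀ {A : Type} [AddCommGroup A] (P : A), (5 : ℕ) • P = (P + P) + ((P + P) + P) := by
    intro A _ P
    simp only [succ_nsmul, zero_nsmul, zero_add, add_assoc]
  rw [h5, two_P, two_P_add_P, add_neg_cancel]

/-- **`P = (0, 2)` has order exactly `5`.** [cite: SilvermanAEC2009, III.2.3] -/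
theorem addOrderOf_P [(⟨0, -1, 1, 10, 6⟩ : WeierstrassCurve ℚ).IsElliptic] :
    addOrderOf (Affine.Point.some (0 : ℚ) (2 : ℚ) nonsingular_P :
      (⟨0, -1, 1, 10, 6⟩ : WeierstrassCurve ℚ).toAffine.Point) = 5 := by
  haveI : Fact (Nat.Prime 5) := ⟨by norm_num⟩
  exact addOrderOf_eq_prime five_smul_P (Affine.Point.some_ne_zero _)

/-- **`155a1[5]` is reducible** (the line spanned by `P`; Mazur 1977 p. 157). [cite: Mazur1977, Ch. III §5, p. 157] -/
theorem not_irreducible_W₀ [(⟨0, -1, 1, 10, 6⟩ : WeierstrassCurve ℚ).IsElliptic] :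
    ¬ (⟨0, -1, 1, 10, 6⟩ : WeierstrassCurve ℚ).HasIrreducibleModPGaloisRep 5 := by
  haveI : Fact (Nat.Prime 5) := ⟨by norm_num⟩
  exact not_hasIrreducibleModPGaloisRep_of_addOrderOf_eq _ addOrderOf_P

/-- **`¬ GVPar 155a1 5` — type A** (a rational `5`-torsion point at the odd multiplicative prime `5`
spans an unramified even line: `X2.not_gvPar_of_nsmul_eq_zero_of_mult`, granted the two
Tate-uniformisation facts). [cite: GreenbergVatsal2000, Thm. (1.3) and §2 p. 28] [cite: SilvermanATAEC1994, Thm. V.5.3 and Cor. V.5.4] -/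
theorem not_gvPar_W₀ (hT : Silverman1994_thmV53_tateUniformisation.{0})
    (hT' : Silverman1994_thmV53_corV54_tateUniformisation.{0}) :
    ¬ GVPar (⟨0, -1, 1, 10, 6⟩ : WeierstrassCurve ℚ) 5 := by
  haveI := isElliptic_W₀
  haveI := isGloballyMinimal_W₀
  haveI : Fact (Nat.Prime 5) := ⟨by norm_num⟩
  exact not_gvPar_of_nsmul_eq_zero_of_mult _ hT hT' (by decide) split_W₀.1 _
    (Affine.Point.some_ne_zero nonsingular_P) five_smul_P

/-! ## §4 The X2c data at the étale end `W₁` (transported along `φ`) -/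

/-- **`(W₁, 5)` is X2 — `5` odd, `W₁[5]` reducible (transported from `W₀` along `φ`), `5 ‖ N` split
multiplicative — and `¬ GVPar W₁ 5` (parity is an isogeny invariant at a multiplicative prime).**
[cite: GreenbergVatsal2000, Thm. (1.3)] [cite: SilvermanATAEC1994, Thm. V.5.3 and Cor. V.5.4] -/
theorem classX2_and_not_gvPar_W₁ (hT : Silverman1994_thmV53_tateUniformisation.{0})
    (hT' : Silverman1994_thmV53_corV54_tateUniformisation.{0}) :
    (haveI : Fact (Nat.Prime 5) := ⟨by norm_num⟩
    ClassX2 (⟨0, -1, 1, -840, -9114⟩ : WeierstrassCurve ℚ) 5 ∧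
      ¬ GVPar (⟨0, -1, 1, -840, -9114⟩ : WeierstrassCurve ℚ) 5) := by
  haveI := isElliptic_W₀
  haveI := isGloballyMinimal_W₀
  haveI := isElliptic_W₁
  haveI := isGloballyMinimal_W₁
  haveI : Fact (Nat.Prime 5) := ⟨by norm_num⟩
  have hiso : IsIsogenous (⟨0, -1, 1, 10, 6⟩ : WeierstrassCurve ℚ) ⟨0, -1, 1, -840, -9114⟩ := ⟨isogeny155a⟩
  refine ⟨⟨by decide, not_hasIrreducibleModPGaloisRep_of_isIsogenous hiso not_irreducible_W₀, split_W₁.1⟩,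
    fun h ↦ not_gvPar_W₀ hT hT' ?_⟩
  exact (gvPar_iff_of_isIsogenous_of_mult hT hT' (by decide) split_W₀.1 hiso).mpr h

end Summit.BirchSwinnertonDyer.Rank1Residual.X2.RankOneSplitSwitchDisplay155a

end
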